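import Literature.Barriers.CriticalPhenomena.LongRangeTrivialityOnZ3NoSlidingScale
import Literature.Barriers.CriticalPhenomena.LongRangeTrivialityOnZ3LeftContinuity

/-!
# Panis's bound on `S(β,L,f) = Σ_L⁻²∑|U₄|` in EVERY dimension `d ≥ 1` from the tree diagram bound,
# the Messager–Miracle-Solé monotonicity and the infrared bound: the named fact
# `panis_ursellFourBoxSum_le` reduced to the tree diagram bound and the printed infrared bounds

Sibling (`…Proofs`) of `Literature/Barriers/CriticalPhenomena/LongRangeTrivialityOnZ3Inputs.lean`
(barrier catalogue D-0021, sub-problem `Ising3DConformalLimit`), where the named fact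
`panis_ursellFourBoxSum_le` vendors, for every `d ≥ 1` and `J_{x,y} = C₀|x-y|₁^{-d-α}` with
`d - 2(α∧2) > 0`, the bound `S(β,L,R) ≤ C(β⁻⁴∨β⁻²)R^γ/L^{d-2(α∧2)}` (`0 < β ≤ β_c`, `L, R ≥ 1`) that
page 22 of Panis 2023 (arXiv:2309.05797, proof of Theorem 5.5) derives. `…UrsellSum` proved its `d = 3`
instance along the printed route (with the sliding-scale infrared bound, Theorem 3.18) and
`…NoSlidingScale` proved the same `d = 3` instance WITHOUT Theorem 3.18, from the tree diagram bound,
MMS2 and the infrared bound. This file runs that second route in **every dimension `d ≥ 1`** — it needs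
no `d ≥ 2` (Theorem 3.18) and it also covers the printed case `d = 1` of Theorem 1.2, which the printed
proof of Theorem 5.5 does not (there Theorem 3.18 is `d ≥ 2` and "`|x - x_i| ≥ (d-1)r_fL`" is empty) —
and thereby derives the general-`d` named fact from the tree diagram bound and the printed infrared
bounds alone, the MMS monotonicity (`panis_mms_two_point_monotone_holds`, `…MMSWalk`) and
`χ_L ≤ C₂L^{-d}Σ_L` (`panis_boxSusceptibility_le_blockVariance_of_mms`, `…Susceptibility`) being theorems
of the tree:

* `LongRangeIsing.ursellFourBoxSum_le_of_mms_irb` — for a general translation-invariant `J ≥ 0` on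
  `ℤ^d`, `d ≥ 1`, and a set `B` of admissible `β ≥ 0`: the tree diagram bound (in `ℝ≥0∞`), MMS2
  (`d|x| ≤ |y| ⇒ ⟨σ₀σ_y⟩ ≤ ⟨σ₀σ_x⟩`), an infrared bound `⟨σ₀σ_x⟩ ≤ C_E|x|^{-(d-2+η)}` with
  `0 ≤ d - 2 + η`, `η < 2` and the effective-dimension condition `d + 2η > 4` of §5, and
  `χ_L ≤ C₂L^{-d}Σ_L`, give `S(β,L,R) ≤ K R^{5d} / L^{d+2η-4}` for all `β ∈ B`, `L, R ≥ 1` (no powers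
  of `β`);
* `panis_infraredBound_rp`, `panis_infraredBound_algebraic_lowDim` — two further PRINTED infrared
  inputs vendored here as named facts, for the corners of the fact's scope that
  `panis_infraredBound_algebraic` of `…TwoPoint` (`d ≥ 3`, `α ≠ 2`) leaves out: Proposition 3.8 (IRB)
  (`⟨σ₀σ_x⟩ ≤ C/(β_c|J||x|^{d-2})`, `d ≥ 3`, every `α`; used for `α ≥ 2`, where `η = 0`) and the first
  display of p. 16 with Remark 3.9 (`d = 2`, `α < 2` and `d = 1`, `α < 1`, printed `1/β` kept; used at
  `β_c` and transported to `β ≤ β_c` by Griffiths' monotonicity in `β`, `pairCorrelation_mono_beta`, from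
  `state_spinProduct_mono_beta` of `…LeftContinuity`); `exists_irb_eta_form` assembles the `η`-form
  `η = 2 - α∧2` in every `d ≥ 1` (Remarks 5.3–5.4: `d + 2η - 4 = d - 2(α∧2)`);
* **`panis_ursellFourBoxSum_le_of_facts : panis_treeDiagramBound → panis_infraredBound_algebraic →
  panis_infraredBound_rp → panis_infraredBound_algebraic_lowDim → panis_ursellFourBoxSum_le`** (all
  `d ≥ 1`; `γ = 5d`; the factor `β⁻⁴ ∨ β⁻²` of the vendored shape recovered from
  `1 ≤ (β_c² + 1)β⁻²` for `β ≤ β_c`), and `panis_thm12_of_facts` (Theorem 1.2, all `d`, from the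
  moment-generating-function display and the same four facts).

## The argument in dimension `d` (p. 22 with MMS2 in place of Theorem 3.18)

With `F(u) := ∑_{y∈Λ_{RL}}⟨σ_uσ_y⟩` (`twoPointBoxSum`) the tree diagram bound gives
`∑_{Λ_{RL}⁴}|U₄| ≤ 2∑_u F(u)⁴` (`sum_box_abs_ursellFour_le`, in `ℝ≥0∞`, Fubini, then back to `ℝ` through
the summable majorant `fourthPowerMajorant`). Split the `u`-sum at `Λ_{(d+1)RL}` (the source splits at
`Λ_{dr_fL}`); for `|u| ≥ (d+1)RL + 1` and `y ∈ Λ_{RL}` one has `|u - y| ≥ dRL + 1` and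
`|u - y| ≥ |u|/2` (`far_geometry`):

* near (`twoPointBoxSum_le_near`): `F(u) ≤ χ_{(d+2)RL} ≤ (1+(3d)^d)((d+2)R)^d χ_L` (translation
  invariance, `sum_box_pairCorrelation_le`, and the MMS2 scale comparison
  `boxSusceptibility_le_scaleRatio_pow_mul` of `…NoSlidingScale` between `L` and `(d+2)RL`);
* far (`pairCorrelation_far_le_mms_gen`, `pairCorrelation_far_le_irb_gen`,
  `twoPointBoxSum_pow_four_le_far`): two factors `⟨σ_uσ_y⟩ ≤ χ_L/L^d` (MMS2 averaged over `Λ_L`,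
  `card_box_mul_pairCorrelation_le_boxSusceptibility`, `|u-y| ≥ dL`), two factors
  `⟨σ_uσ_y⟩ ≤ C_E2^{d-2+η}|u|^{-(d-2+η)}`, whence `F(u)⁴ ≤ B|u|^{-(2d-4+2η)}`; the tail
  `∑_{|u|>M}|u|^{-q} ≤ 2d3^{d-1}M^{d-q}/(q-d)` (`sum_box_sdiff_rpow_neg_supNorm_le`, spheres
  `|∂Λ_k| ≤ 2d3^{d-1}k^{d-1}`) converges since `q - d = d - 4 + 2η > 0` — exactly the effective-dimension
  condition, in every `d ≥ 1`;
* bookkeeping (`near_term_le_gen`, `far_term_le_gen`, `boxSusceptibility_le_of_irb_gen`):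
  `χ_L/Σ_L ≤ C₂L^{-d}` twice, `χ_L ≤ C₄L^{2-η}` (`C₄ = 1 + 2d3^{d-1}C_E(1+1/(2-η))`, from
  `∑_{0<|x|≤L}|x|^{-(d-2+η)} ≤ 2d3^{d-1}(1+1/(2-η))L^{2-η}`, `sum_box_rpow_neg_supNorm_le`), giving
  `S ≤ (K₁R^{5d} + K₂R^{4d})L^{4-2η-d}`.

After this file the general-`d` fact `panis_ursellFourBoxSum_le` (hence `panis_thm12`, all `d`, granted
the moment display `panis_mgfDeviation_le_ursellFourBoxSum`) rests on the tree diagram bound (§4.2,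
Aizenman 1982; random currents) and the printed infrared bounds (Proposition 3.8, p. 16, Remark 3.9;
reflection positivity across coordinate mirrors and Gaussian domination), each a theory of its own.

## References

* R. Panis, arXiv:2309.05797 (2023) = Ann. Probab. 54 (2026): proof of Theorem 5.5 (pp. 21–22),
  Theorem 1.2, Remarks 5.3–5.4, §3.2 (Corollary 3.3), §3.3 (Proposition 3.8, display (IRB); first
  display of p. 16; Remark 3.9), §3.6 (last display of p. 16), §4.2 [Panis2023Triviality] (held; read
  pp. 5–6, 13–16, 21–22).
* M. Aizenman, H. Duminil-Copin, Ann. Math. 194 (2021), remark following Theorem 5.6 (the naive MMS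
  comparison of `χ` between scales) [AizenmanDuminilCopinAnnals2021].
-/

noncomputable section

namespace Literature.Barriers.CriticalPhenomena

open Literature.Probability.LatticeModels Literature.Probability.Percolation Filter Topology Finset
open scoped ENNReal symmDiff

namespace LongRangeIsing

variable {d : ℕ}

/-! ### Lattice sums in `ℤ^d`: spheres, `∑_{0<|x|≤L}|x|^{-(d-2+η)}`, `∑_{|x|>M}|x|^{-q}` -/

section LatticeSumsGen

/-- In `ℤ^d`, `|∂Λ_k| ≤ 2d·3^{d-1} k^{d-1}` for `k ≥ 1` (`|∂Λ_k| ≤ 2d(2k+1)^{d-1}` and `2k+1 ≤ 3k`).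
[folklore] -/
theorem card_sphere_le_mul_pow {k : ℕ} (hk : 1 ≤ k) :
    (#(sphere d k) : ℝ) ≤ 2 * d * (3 : ℝ) ^ (d - 1) * (k : ℝ) ^ (d - 1) := by
  obtain ⟨j, rfl⟩ : ∃ j, k = j + 1 := ⟨k - 1, by omega⟩
  have h := card_sphere_succ_le (d := d) j
  have h3 : (2 * j + 3 : ℝ) ≤ 3 * ((j + 1 : ℕ) : ℝ) := by push_cast; linarith
  calc (#(sphere d (j + 1)) : ℝ) ≤ 2 * d * (2 * j + 3 : ℝ) ^ (d - 1) := h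
    _ ≤ 2 * d * (3 * ((j + 1 : ℕ) : ℝ)) ^ (d - 1) := by
        gcongr
    _ = 2 * d * (3 : ℝ) ^ (d - 1) * ((j + 1 : ℕ) : ℝ) ^ (d - 1) := by rw [mul_pow]; ring

/-- **Far tail in `ℤ^d`**: for real `q > d ≥ 1`, `M ≥ 1` and every `N`,
`∑_{u ∈ Λ_N ∖ Λ_M} |u|_∞^{-q} ≤ 2d3^{d-1} M^{d-q}/(q-d)`. [folklore] -/
theorem sum_box_sdiff_rpow_neg_supNorm_le (hd : 1 ≤ d) {q : ℝ} (hq : (d : ℝ) < q) {M : ℕ} (hM : 1 ≤ M) (N : ℕ) :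
    ∑ u ∈ box d N \ box d M, ((Site.supNorm u : ℝ)) ^ (-q) ≤
      2 * d * (3 : ℝ) ^ (d - 1) * (M : ℝ) ^ ((d : ℝ) - q) / (q - d) := by
  rw [sum_box_sdiff_eq_sum_sphere (fun k => ((k : ℝ)) ^ (-q)) M N]
  have hd1 : ((d - 1 : ℕ) : ℝ) = (d : ℝ) - 1 := by rw [Nat.cast_sub hd, Nat.cast_one]
  have hterm : ∀ k ∈ Finset.Ioc M N,
      (#(sphere d k) : ℝ) * ((k : ℝ)) ^ (-q) ≤ 2 * d * (3 : ℝ) ^ (d - 1) * (k : ℝ) ^ (-(q - d + 1)) := by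
    intro k hk
    rw [Finset.mem_Ioc] at hk
    have hk1 : 1 ≤ k := by omega
    have hk0 : (0 : ℝ) < k := by exact_mod_cast hk1
    calc (#(sphere d k) : ℝ) * ((k : ℝ)) ^ (-q) ≤ 2 * d * (3 : ℝ) ^ (d - 1) * (k : ℝ) ^ (d - 1) * ((k : ℝ)) ^ (-q) :=
          mul_le_mul_of_nonneg_right (card_sphere_le_mul_pow hk1) (Real.rpow_nonneg hk0.le _)
      _ = 2 * d * (3 : ℝ) ^ (d - 1) * ((k : ℝ) ^ (((d - 1 : ℕ) : ℝ)) * (k : ℝ) ^ (-q)) := by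
          rw [Real.rpow_natCast]; ring
      _ = 2 * d * (3 : ℝ) ^ (d - 1) * (k : ℝ) ^ (-(q - d + 1)) := by
          rw [← Real.rpow_add hk0, hd1]
          congr 1
          ring_nf
  have hq1 : 1 < q - d + 1 := by linarith
  have hK0 : (0 : ℝ) ≤ 2 * d * (3 : ℝ) ^ (d - 1) := by positivity
  calc ∑ k ∈ Finset.Ioc M N, (#(sphere d k) : ℝ) * ((k : ℝ)) ^ (-q)
      ≤ ∑ k ∈ Finset.Ioc M N, 2 * d * (3 : ℝ) ^ (d - 1) * (k : ℝ) ^ (-(q - d + 1)) := Finset.sum_le_sum hterm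
    _ = 2 * d * (3 : ℝ) ^ (d - 1) * ∑ k ∈ Finset.Ioc M N, (k : ℝ) ^ (-(q - d + 1)) := by rw [Finset.mul_sum]
    _ ≤ 2 * d * (3 : ℝ) ^ (d - 1) * ((M : ℝ) ^ (1 - (q - d + 1)) / (q - d + 1 - 1)) :=
        mul_le_mul_of_nonneg_left (sum_Ioc_rpow_neg_le hq1 hM N) hK0
    _ = 2 * d * (3 : ℝ) ^ (d - 1) * (M : ℝ) ^ ((d : ℝ) - q) / (q - d) := by
        rw [show (1 : ℝ) - (q - d + 1) = d - q by ring, show q - d + 1 - 1 = q - d by ring]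
        ring

/-- **`∑_{x ∈ Λ_L ∖ Λ_0} |x|_∞^{-(d-2+η)} ≤ 2d3^{d-1}(1 + 1/(2-η)) L^{2-η}` in `ℤ^d`** (`d ≥ 1`, `η < 2`,
`L ≥ 1`): spheres of size `≤ 2d3^{d-1}k^{d-1}` and `∑_{k ≤ L} k^{1-η}`. This is the estimate behind
"`χ_L(β) ≤ C₄L^{2-η}`" in the bound on (1), p. 22 of the source.
[cite: Panis2023Triviality, proof of Theorem 5.5, bound on (1) ("χ_L(β) ≤ C_4 L^{2-η}"), p. 22] -/
theorem sum_box_rpow_neg_supNorm_le (hd : 1 ≤ d) {η : ℝ} (hη2 : η < 2) {L : ℕ} (hL : 1 ≤ L) :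
    ∑ u ∈ box d L \ box d 0, ((Site.supNorm u : ℝ)) ^ (-((d : ℝ) - 2 + η)) ≤
      2 * d * (3 : ℝ) ^ (d - 1) * (1 + 1 / (2 - η)) * (L : ℝ) ^ (2 - η) := by
  rw [sum_box_sdiff_eq_sum_sphere (fun k => ((k : ℝ)) ^ (-((d : ℝ) - 2 + η))) 0 L]
  have hIoc : Finset.Ioc 0 L = Finset.Icc 1 L := by
    ext k
    simp only [Finset.mem_Ioc, Finset.mem_Icc]
    omega
  rw [hIoc]
  have hd1 : ((d - 1 : ℕ) : ℝ) = (d : ℝ) - 1 := by rw [Nat.cast_sub hd, Nat.cast_one]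
  have hK0 : (0 : ℝ) ≤ 2 * d * (3 : ℝ) ^ (d - 1) := by positivity
  have hterm : ∀ k ∈ Finset.Icc 1 L, (#(sphere d k) : ℝ) * ((k : ℝ)) ^ (-((d : ℝ) - 2 + η)) ≤
      2 * d * (3 : ℝ) ^ (d - 1) * (k : ℝ) ^ (1 - η) := by
    intro k hk
    rw [Finset.mem_Icc] at hk
    have hk0 : (0 : ℝ) < k := by exact_mod_cast hk.1
    calc (#(sphere d k) : ℝ) * ((k : ℝ)) ^ (-((d : ℝ) - 2 + η))
        ≤ 2 * d * (3 : ℝ) ^ (d - 1) * (k : ℝ) ^ (d - 1) * ((k : ℝ)) ^ (-((d : ℝ) - 2 + η)) :=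
          mul_le_mul_of_nonneg_right (card_sphere_le_mul_pow hk.1) (Real.rpow_nonneg hk0.le _)
      _ = 2 * d * (3 : ℝ) ^ (d - 1) * ((k : ℝ) ^ (((d - 1 : ℕ) : ℝ)) * (k : ℝ) ^ (-((d : ℝ) - 2 + η))) := by
          rw [Real.rpow_natCast]; ring
      _ = 2 * d * (3 : ℝ) ^ (d - 1) * (k : ℝ) ^ (1 - η) := by
          rw [← Real.rpow_add hk0, hd1]
          congr 1
          ring_nf
  calc ∑ k ∈ Finset.Icc 1 L, (#(sphere d k) : ℝ) * ((k : ℝ)) ^ (-((d : ℝ) - 2 + η))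
      ≤ ∑ k ∈ Finset.Icc 1 L, 2 * d * (3 : ℝ) ^ (d - 1) * (k : ℝ) ^ (1 - η) := Finset.sum_le_sum hterm
    _ = 2 * d * (3 : ℝ) ^ (d - 1) * ∑ k ∈ Finset.Icc 1 L, (k : ℝ) ^ (1 - η) := by rw [Finset.mul_sum]
    _ ≤ 2 * d * (3 : ℝ) ^ (d - 1) * ((1 + 1 / (2 - η)) * (L : ℝ) ^ (2 - η)) :=
        mul_le_mul_of_nonneg_left (sum_Icc_rpow_one_sub_le hη2 hL) hK0
    _ = 2 * d * (3 : ℝ) ^ (d - 1) * (1 + 1 / (2 - η)) * (L : ℝ) ^ (2 - η) := by ring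

end LatticeSumsGen



/-! ### Monotonicity of the two-point function in `β` (Griffiths II) -/

section BetaMonotone

variable (J : Site d → Site d → ℝ)

/-- `⟨σ_xσ_y⟩_β ≤ ⟨σ_xσ_y⟩_{β'}` for `0 ≤ β ≤ β'`, `J ≥ 0` (Griffiths' comparison of couplings, through
`state_spinProduct_mono_beta`; "`S_{ρ,β}(x) ≤ S_{ρ,β_c(ρ)}(x)`" in Proposition 3.8).
[cite: Panis2023Triviality, Proposition 3.8, display (IRB) (S_{ρ,β}(x) ≤ S_{ρ,β_c(ρ)}(x))] -/
theorem pairCorrelation_mono_beta {β β' : ℝ} (hβ : 0 ≤ β) (hββ' : β ≤ β') (hJ : ∀ x y, 0 ≤ J x y)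
    (x y : Site d) : pairCorrelation J β x y ≤ pairCorrelation J β' x y := by
  rw [pairCorrelation_eq, pairCorrelation_eq]
  exact state_spinProduct_mono_beta J hJ hβ hββ' _

end BetaMonotone

/-! ### The two-point function of `ℤ^d` far from a box: MMS2 and the infrared bound (p. 22, bound
on (2), with MMS2 in place of Theorem 3.18) -/

section FarBoundsGen

variable (J : Site d → Site d → ℝ) (β : ℝ)

/-- **Geometry of the far region.** For `|u|_∞ ≥ (d+1)N + 1` and `y ∈ Λ_N`:
`|y - u|_∞ ≥ dN + 1` and `|u|_∞ ≤ 2|y - u|_∞`. [folklore] -/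
theorem far_geometry (hd : 1 ≤ d) {N : ℕ} {u y : Site d} (hu : (d + 1) * N + 1 ≤ Site.supNorm u)
    (hy : y ∈ box d N) :
    d * N + 1 ≤ Site.supNorm (y - u) ∧ Site.supNorm u ≤ 2 * Site.supNorm (y - u) := by
  have hd0 : 0 < d := hd
  have hyN : Site.supNorm y ≤ N := mem_box_iff_supNorm_le.1 hy
  have htri : Site.supNorm u ≤ Site.supNorm (y - u) + Site.supNorm y := by
    have h := Site.supNorm_le_supNorm_sub_add u y
    rwa [← Site.supNorm_neg (u - y), neg_sub] at h
  have e1 : (d + 1) * N = d * N + N := by ring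
  have h6 : N ≤ d * N := Nat.le_mul_of_pos_left N hd0
  constructor <;> omega

/-- **MMS2, far from the box** (in place of display (5.2) of the source): if `⟨σ₀σ_b⟩ ≤ ⟨σ₀σ_a⟩` for
`d|a|_∞ ≤ |b|_∞`, then for `|u|_∞ ≥ (d+1)N+1`, `y ∈ Λ_N` and `L ≤ N`,
`⟨σ_uσ_y⟩ ≤ χ_L(β)/L^d` — indeed `|u-y|_∞ ≥ dN+1 ≥ dL`, so MMS2 compares `⟨σ₀σ_{y-u}⟩` with every
`⟨σ₀σ_z⟩`, `z ∈ Λ_L`, and `|Λ_L| ≥ L^d`.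
[cite: Panis2023Triviality, Corollary 3.3 (MMS2), and proof of Proposition 3.8, first display] -/
theorem pairCorrelation_far_le_mms_gen (hd : 1 ≤ d) (hβ : 0 ≤ β) (hJ : ∀ x y, 0 ≤ J x y)
    (hJt : ∀ a x y, J (x + a) (y + a) = J x y)
    (hmms : ∀ x y : Site d, (d : ℝ) * ‖x‖ ≤ ‖y‖ → pairCorrelation J β 0 y ≤ pairCorrelation J β 0 x)
    {N L : ℕ} (hL : 1 ≤ L) (hLN : L ≤ N) {u y : Site d} (hu : (d + 1) * N + 1 ≤ Site.supNorm u)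
    (hy : y ∈ box d N) :
    pairCorrelation J β u y ≤ boxSusceptibility J β L / (L : ℝ) ^ d := by
  obtain ⟨h1, -⟩ := far_geometry hd hu hy
  have hw : d * L ≤ Site.supNorm (y - u) := by
    have : d * L ≤ d * N := Nat.mul_le_mul_left d hLN
    omega
  have hχ0 : 0 ≤ boxSusceptibility J β L := boxSusceptibility_nonneg J β hβ hJ L
  have hcardL : (L : ℝ) ^ d ≤ #(box d L) := by
    rw [card_box]
    exact_mod_cast Nat.pow_le_pow_left (by omega : L ≤ 2 * L + 1) d
  have hLd : (0 : ℝ) < (L : ℝ) ^ d := by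
    have hL0 : (0 : ℝ) < L := by exact_mod_cast hL
    positivity
  have hcard0 : (0 : ℝ) < #(box d L) := by exact_mod_cast (box_nonempty d L).card_pos
  have h := card_box_mul_pairCorrelation_le_boxSusceptibility J β hmms hw
  rw [pairCorrelation_zero_sub J β hβ hJ hJt u y] at h
  calc pairCorrelation J β u y ≤ boxSusceptibility J β L / #(box d L) := by
        rw [le_div_iff₀ hcard0, mul_comm]
        exact h
    _ ≤ boxSusceptibility J β L / (L : ℝ) ^ d := div_le_div_of_nonneg_left hχ0 hLd hcardL

/-- **Infrared bound, far from the box**: if `⟨σ₀σ_x⟩ ≤ C_E |x|_∞^{-p}` (`x ≠ 0`, `p ≥ 0`), then for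
`|u|_∞ ≥ (d+1)N+1` and `y ∈ Λ_N`, `⟨σ_uσ_y⟩ ≤ C_E 2^p |u|_∞^{-p}` (`|u-y| ≥ |u|/2`).
[cite: Panis2023Triviality, proof of Theorem 5.5, bound on (2) ("the other two using (5.1)"), p. 22] -/
theorem pairCorrelation_far_le_irb_gen (hd : 1 ≤ d) (hβ : 0 ≤ β) (hJ : ∀ x y, 0 ≤ J x y)
    (hJt : ∀ a x y, J (x + a) (y + a) = J x y) {p : ℝ} (hp : 0 ≤ p) {CE : ℝ} (hCE : 0 ≤ CE)
    (hE : ∀ x : Site d, x ≠ 0 → pairCorrelation J β 0 x ≤ CE / ‖x‖ ^ p)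
    {N : ℕ} {u y : Site d} (hu : (d + 1) * N + 1 ≤ Site.supNorm u) (hy : y ∈ box d N) :
    pairCorrelation J β u y ≤ CE * (2 : ℝ) ^ p * (Site.supNorm u : ℝ) ^ (-p) := by
  obtain ⟨h1, h5⟩ := far_geometry hd hu hy
  set w : Site d := y - u with hw
  have hwpos : 0 < Site.supNorm w := by omega
  have hupos : 0 < Site.supNorm u := by omega
  have hw0 : w ≠ 0 := fun h => by rw [h, Site.supNorm_eq_zero_iff.2 rfl] at hwpos; exact lt_irrefl 0 hwpos
  have hu0 : (0 : ℝ) < Site.supNorm u := by exact_mod_cast hupos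
  have hn0 : (0 : ℝ) < Site.supNorm w := by exact_mod_cast hwpos
  have hEw := hE w hw0
  rw [Site.norm_eq_supNorm] at hEw
  have hhalf : (Site.supNorm u : ℝ) / 2 ≤ Site.supNorm w := by
    have : (Site.supNorm u : ℝ) ≤ 2 * Site.supNorm w := by exact_mod_cast h5
    linarith
  have hratio : ((Site.supNorm w : ℝ)) ^ (-p) ≤ (2 : ℝ) ^ p * (Site.supNorm u : ℝ) ^ (-p) := by
    calc ((Site.supNorm w : ℝ)) ^ (-p) ≤ ((Site.supNorm u : ℝ) / 2) ^ (-p) :=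
          Real.rpow_le_rpow_of_nonpos (by positivity) hhalf (by linarith)
      _ = (Site.supNorm u : ℝ) ^ (-p) / (2 : ℝ) ^ (-p) := Real.div_rpow hu0.le (by norm_num) _
      _ = (2 : ℝ) ^ p * (Site.supNorm u : ℝ) ^ (-p) := by
          rw [Real.rpow_neg (by norm_num : (0 : ℝ) ≤ 2), div_inv_eq_mul, mul_comm]
  rw [← pairCorrelation_zero_sub J β hβ hJ hJt u y]
  calc pairCorrelation J β 0 (y - u) = pairCorrelation J β 0 w := by rw [hw]
    _ ≤ CE / (Site.supNorm w : ℝ) ^ p := hEw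
    _ = CE * (Site.supNorm w : ℝ) ^ (-p) := by rw [Real.rpow_neg hn0.le, div_eq_mul_inv]
    _ ≤ CE * ((2 : ℝ) ^ p * (Site.supNorm u : ℝ) ^ (-p)) := mul_le_mul_of_nonneg_left hratio hCE
    _ = CE * (2 : ℝ) ^ p * (Site.supNorm u : ℝ) ^ (-p) := by ring

end FarBoundsGen

/-! ### Row sums `F_N(u) = ∑_{y∈Λ_N}⟨σ_uσ_y⟩`, a summable majorant of `F⁴`, the summed tree bound -/

section RowSumsGen

variable (J : Site d → Site d → ℝ) (β : ℝ)

/-- `F_N(u) := ∑_{y ∈ Λ_N} ⟨σ_uσ_y⟩_β` in `ℤ^d` (the inner sums of (1) and (2), p. 22; the `d = 3` copy is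
`boxRowSum`). [cite: Panis2023Triviality, proof of Theorem 5.5, bound on (1) (first display), p. 22] -/
def twoPointBoxSum (N : ℕ) (u : Site d) : ℝ := ∑ y ∈ box d N, pairCorrelation J β u y

/-- `F_N(u) ≥ 0`. [folklore] -/
theorem twoPointBoxSum_nonneg (hβ : 0 ≤ β) (hJ : ∀ x y, 0 ≤ J x y) (N : ℕ) (u : Site d) :
    0 ≤ twoPointBoxSum J β N u :=
  Finset.sum_nonneg fun y _ => pairCorrelation_nonneg J β hβ hJ u y

/-- **Near the box** (bound on (1), with MMS2 in place of Theorem 3.18): for `u ∈ Λ_M` and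
`1 ≤ L ≤ N + M`, `F_N(u) ≤ χ_{N+M}(β) ≤ (1+(3d)^d)((N+M)/L)^d χ_L(β)` (translation invariance, then the
MMS2 comparison of `χ` between the scales `L` and `N + M`).
[cite: Panis2023Triviality, proof of Theorem 5.5, bound on (1), p. 22, with Corollary 3.3 (MMS2)] -/
theorem twoPointBoxSum_le_near (hβ : 0 ≤ β) (hJ : ∀ x y, 0 ≤ J x y) (hJt : ∀ a x y, J (x + a) (y + a) = J x y)
    (hmms : ∀ x y : Site d, (d : ℝ) * ‖x‖ ≤ ‖y‖ → pairCorrelation J β 0 y ≤ pairCorrelation J β 0 x)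
    {N M L : ℕ} (hL : 1 ≤ L) (hLNM : L ≤ N + M) {u : Site d} (hu : u ∈ box d M) :
    twoPointBoxSum J β N u ≤ (1 + ((3 * d) ^ d : ℕ)) * (((N + M : ℕ) : ℝ) / L) ^ d * boxSusceptibility J β L :=
  (sum_box_pairCorrelation_le J β hβ hJ hJt (N := N) hu).trans
    (boxSusceptibility_le_scaleRatio_pow_mul J β hβ hJ hmms hL hLNM)

/-- `(U^{-p})² = U^{-2p}` for `U ≥ 0`. [folklore] -/
theorem rpow_neg_sq {U : ℝ} (hU : 0 ≤ U) (p : ℝ) : (U ^ (-p)) ^ 2 = U ^ (-(2 * p)) := by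
  rw [← Real.rpow_natCast (U ^ (-p)) 2, ← Real.rpow_mul hU]
  congr 1
  push_cast
  ring

/-- **Far from the box** (bound on (2), with MMS2 in place of Theorem 3.18): for `|u|_∞ ≥ (d+1)N+1`,
`1 ≤ L ≤ N`, `F_N(u)⁴ ≤ B |u|_∞^{-2(d-2+η)}` with `B = |Λ_N|⁴ (χ_L/L^d)² (C_E 2^{d-2+η})²` (two factors
through MMS2, two through the infrared bound `⟨σ₀σ_x⟩ ≤ C_E|x|^{-(d-2+η)}`, `d - 2 + η ≥ 0`).
[cite: Panis2023Triviality, proof of Theorem 5.5, bound on (2), p. 22, with Corollary 3.3 (MMS2)] -/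
theorem twoPointBoxSum_pow_four_le_far (hd : 1 ≤ d) (hβ : 0 ≤ β) (hJ : ∀ x y, 0 ≤ J x y)
    (hJt : ∀ a x y, J (x + a) (y + a) = J x y)
    (hmms : ∀ x y : Site d, (d : ℝ) * ‖x‖ ≤ ‖y‖ → pairCorrelation J β 0 y ≤ pairCorrelation J β 0 x)
    {η : ℝ} (hp0 : 0 ≤ (d : ℝ) - 2 + η) {CE : ℝ} (hCE : 0 ≤ CE)
    (hE : ∀ x : Site d, x ≠ 0 → pairCorrelation J β 0 x ≤ CE / ‖x‖ ^ ((d : ℝ) - 2 + η))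
    {N L : ℕ} (hL : 1 ≤ L) (hLN : L ≤ N) {u : Site d} (hu : (d + 1) * N + 1 ≤ Site.supNorm u) :
    twoPointBoxSum J β N u ^ 4 ≤
      (((2 * N + 1 : ℕ) : ℝ) ^ d) ^ 4 * (boxSusceptibility J β L / (L : ℝ) ^ d) ^ 2 *
        (CE * (2 : ℝ) ^ ((d : ℝ) - 2 + η)) ^ 2 * (Site.supNorm u : ℝ) ^ (-(2 * ((d : ℝ) - 2 + η))) := by
  set V : ℝ := ((2 * N + 1 : ℕ) : ℝ) ^ d with hV
  set Nu : ℝ := (Site.supNorm u : ℝ) with hNu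
  set p : ℝ := (d : ℝ) - 2 + η with hp
  have hNu0 : 0 ≤ Nu := by rw [hNu]; exact Nat.cast_nonneg _
  set b₁ : ℝ := boxSusceptibility J β L / (L : ℝ) ^ d with hb₁
  set b₂ : ℝ := CE * (2 : ℝ) ^ p * Nu ^ (-p) with hb₂
  have hF0 : 0 ≤ twoPointBoxSum J β N u := twoPointBoxSum_nonneg J β hβ hJ _ u
  have hcard : (#(box d N) : ℝ) = V := by rw [card_box, hV]; norm_cast
  have hF1 : twoPointBoxSum J β N u ≤ V * b₁ := by
    rw [twoPointBoxSum, ← hcard, ← nsmul_eq_mul, ← Finset.sum_const]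
    exact Finset.sum_le_sum fun y hy => pairCorrelation_far_le_mms_gen J β hd hβ hJ hJt hmms hL hLN hu hy
  have hF2 : twoPointBoxSum J β N u ≤ V * b₂ := by
    rw [twoPointBoxSum, ← hcard, ← nsmul_eq_mul, ← Finset.sum_const]
    exact Finset.sum_le_sum fun y hy => pairCorrelation_far_le_irb_gen J β hd hβ hJ hJt hp0 hCE hE hu hy
  have hsq1 : twoPointBoxSum J β N u ^ 2 ≤ (V * b₁) ^ 2 := pow_le_pow_left₀ hF0 hF1 2
  have hsq2 : twoPointBoxSum J β N u ^ 2 ≤ (V * b₂) ^ 2 := pow_le_pow_left₀ hF0 hF2 2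
  have h4 : twoPointBoxSum J β N u ^ 4 ≤ (V * b₁) ^ 2 * (V * b₂) ^ 2 := by
    rw [show twoPointBoxSum J β N u ^ 4 = twoPointBoxSum J β N u ^ 2 * twoPointBoxSum J β N u ^ 2 by ring]
    exact mul_le_mul hsq1 hsq2 (sq_nonneg _) (sq_nonneg _)
  refine h4.trans (le_of_eq ?_)
  rw [hb₁, hb₂, ← rpow_neg_sq hNu0 p]
  ring

/-- The majorant of `F_N(u)⁴` in `ℤ^d`: `A` on `Λ_M`, `B |u|_∞^{-q}` outside (the `d = 3` copy is
`rowMajorant`). [folklore] -/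
def fourthPowerMajorant (A B q : ℝ) (M : ℕ) (u : Site d) : ℝ :=
  if u ∈ box d M then A else B * (Site.supNorm u : ℝ) ^ (-q)

/-- The majorant is nonnegative for `A, B ≥ 0`. [folklore] -/
theorem fourthPowerMajorant_nonneg {A B : ℝ} (hA : 0 ≤ A) (hB : 0 ≤ B) (q : ℝ) (M : ℕ) (u : Site d) :
    0 ≤ fourthPowerMajorant A B q M u := by
  unfold fourthPowerMajorant
  split_ifs
  · exact hA
  · exact mul_nonneg hB (Real.rpow_nonneg (Nat.cast_nonneg _) _)

/-- **Finite sums of the majorant are uniformly bounded**: for `q > d ≥ 1`, `M ≥ 1` and every finite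
`s ⊆ ℤ^d`, `∑_{u∈s} (A 1_{Λ_M} + B|u|^{-q} 1_{Λ_Mᶜ}) ≤ |Λ_M| A + B · 2d3^{d-1} M^{d-q}/(q-d)`. [folklore] -/
theorem sum_fourthPowerMajorant_le (hd : 1 ≤ d) {A B q : ℝ} (hA : 0 ≤ A) (hB : 0 ≤ B) (hq : (d : ℝ) < q)
    {M : ℕ} (hM : 1 ≤ M) (s : Finset (Site d)) :
    ∑ u ∈ s, fourthPowerMajorant A B q M u ≤
      (#(box d M) : ℝ) * A + B * (2 * d * (3 : ℝ) ^ (d - 1) * (M : ℝ) ^ ((d : ℝ) - q) / (q - d)) := by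
  obtain ⟨N₀, hN₀⟩ := exists_forall_subset_box d s
  set N : ℕ := max N₀ M with hN
  have hsN : s ⊆ box d N := hN₀ N (le_max_left _ _)
  have hMN : M ≤ N := le_max_right _ _
  have h0 : ∀ u : Site d, 0 ≤ fourthPowerMajorant A B q M u := fourthPowerMajorant_nonneg hA hB q M
  calc ∑ u ∈ s, fourthPowerMajorant A B q M u ≤ ∑ u ∈ box d N, fourthPowerMajorant A B q M u :=
        Finset.sum_le_sum_of_subset_of_nonneg hsN fun u _ _ => h0 u
    _ = ∑ u ∈ box d N \ box d M, fourthPowerMajorant A B q M u + ∑ u ∈ box d M, fourthPowerMajorant A B q M u :=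
        (Finset.sum_sdiff (box_mono d hMN)).symm
    _ = B * ∑ u ∈ box d N \ box d M, (Site.supNorm u : ℝ) ^ (-q) + (#(box d M) : ℝ) * A := by
        congr 1
        · rw [Finset.mul_sum]
          refine Finset.sum_congr rfl fun u hu => ?_
          rw [fourthPowerMajorant, if_neg (Finset.mem_sdiff.1 hu).2]
        · rw [Finset.sum_congr rfl fun u hu => by rw [fourthPowerMajorant, if_pos hu], Finset.sum_const, nsmul_eq_mul]
    _ ≤ B * (2 * d * (3 : ℝ) ^ (d - 1) * (M : ℝ) ^ ((d : ℝ) - q) / (q - d)) + (#(box d M) : ℝ) * A := by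
        have h := sum_box_sdiff_rpow_neg_supNorm_le hd hq hM N
        nlinarith
    _ = (#(box d M) : ℝ) * A + B * (2 * d * (3 : ℝ) ^ (d - 1) * (M : ℝ) ^ ((d : ℝ) - q) / (q - d)) := by ring

/-- The majorant is summable over `ℤ^d`, with the same bound on its sum. [folklore] -/
theorem summable_fourthPowerMajorant (hd : 1 ≤ d) {A B q : ℝ} (hA : 0 ≤ A) (hB : 0 ≤ B) (hq : (d : ℝ) < q)
    {M : ℕ} (hM : 1 ≤ M) :
    Summable (fourthPowerMajorant (d := d) A B q M) ∧
      ∑' u, fourthPowerMajorant (d := d) A B q M u ≤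
        (#(box d M) : ℝ) * A + B * (2 * d * (3 : ℝ) ^ (d - 1) * (M : ℝ) ^ ((d : ℝ) - q) / (q - d)) :=
  ⟨summable_of_sum_le (fourthPowerMajorant_nonneg hA hB q M) (sum_fourthPowerMajorant_le hd hA hB hq hM),
    Real.tsum_le_of_sum_le (fourthPowerMajorant_nonneg hA hB q M) (sum_fourthPowerMajorant_le hd hA hB hq hM)⟩

/-- One quadruple: the tree diagram bound with the product written over `Fin 4` (any `d`; the `d = 3`
copy is `treeDiagram_prod_form`). [folklore] -/
theorem abs_ursellFour_le_tsum_prod (hβ : 0 ≤ β) (hJ : ∀ x y, 0 ≤ J x y)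
    (hT : ∀ x y z t : Site d, ENNReal.ofReal |ursellFour J β x y z t| ≤
      2 * ∑' u : Site d, ENNReal.ofReal (pairCorrelation J β x u * pairCorrelation J β y u *
        pairCorrelation J β z u * pairCorrelation J β t u))
    (x : Fin 4 → Site d) :
    ENNReal.ofReal |ursellFour J β (x 0) (x 1) (x 2) (x 3)| ≤
      2 * ∑' u : Site d, ∏ i : Fin 4, ENNReal.ofReal (pairCorrelation J β (x i) u) := by
  have hS0 : ∀ x u, 0 ≤ pairCorrelation J β x u := fun x u => pairCorrelation_nonneg J β hβ hJ x u
  have hprod : ∀ u : Site d, ∏ i : Fin 4, ENNReal.ofReal (pairCorrelation J β (x i) u) =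
      ENNReal.ofReal (pairCorrelation J β (x 0) u * pairCorrelation J β (x 1) u *
        pairCorrelation J β (x 2) u * pairCorrelation J β (x 3) u) := by
    intro u
    rw [Fin.prod_univ_four, ENNReal.ofReal_mul (mul_nonneg (mul_nonneg (hS0 _ _) (hS0 _ _)) (hS0 _ _)),
      ENNReal.ofReal_mul (mul_nonneg (hS0 _ _) (hS0 _ _)), ENNReal.ofReal_mul (hS0 _ _)]
  simp_rw [hprod]
  exact hT (x 0) (x 1) (x 2) (x 3)

/-- The sum over `Λ_N⁴` of `∏ᵢ ⟨σ_{xᵢ}σ_u⟩` is `F_N(u)⁴` (in `ℝ≥0∞`; any `d`). [folklore] -/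
theorem sum_piFinset_prod_pairCorrelation (hβ : 0 ≤ β) (hJ : ∀ x y, 0 ≤ J x y) (N : ℕ) (u : Site d) :
    ∑ x ∈ Fintype.piFinset (fun _ : Fin 4 => box d N), ∏ i : Fin 4, ENNReal.ofReal (pairCorrelation J β (x i) u) =
      ENNReal.ofReal (twoPointBoxSum J β N u ^ 4) := by
  have hS0 : ∀ x u, 0 ≤ pairCorrelation J β x u := fun x u => pairCorrelation_nonneg J β hβ hJ x u
  have h1 : ∑ x ∈ Fintype.piFinset (fun _ : Fin 4 => box d N), ∏ i : Fin 4, ENNReal.ofReal (pairCorrelation J β (x i) u) =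
      ∏ _i : Fin 4, ∑ y ∈ box d N, ENNReal.ofReal (pairCorrelation J β y u) :=
    (Finset.prod_univ_sum (fun _ : Fin 4 => box d N) fun _ y => ENNReal.ofReal (pairCorrelation J β y u)).symm
  have h2 : ∑ y ∈ box d N, ENNReal.ofReal (pairCorrelation J β y u) = ENNReal.ofReal (twoPointBoxSum J β N u) := by
    rw [twoPointBoxSum, ENNReal.ofReal_sum_of_nonneg fun y _ => hS0 u y]
    exact Finset.sum_congr rfl fun y _ => by rw [pairCorrelation_comm J β y u]
  rw [h1, Finset.prod_const, Finset.card_univ, Fintype.card_fin, h2,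
    ENNReal.ofReal_pow (twoPointBoxSum_nonneg J β hβ hJ N u)]

/-- **The tree diagram bound summed over the box** (any `d`): if `|U₄| ≤ 2∑_u ∏⟨σ_{xᵢ}σ_u⟩` (in `ℝ≥0∞`)
and `F_N(u)⁴ ≤ g(u)` with `g ≥ 0` summable, then `∑_{x∈Λ_N⁴} |U₄(x)| ≤ 2 ∑_u g(u)`
("`S(β,L,f) ≤ 2∑_x ∑_{x₁,…,x₄}⟨σ_xσ_{x₁}⟩⋯⟨σ_xσ_{x₄}⟩/Σ_L² = 2∑_x (∑_y⟨σ_xσ_y⟩)⁴/Σ_L²`", p. 22; the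
`d = 3` copy is `sum_abs_ursellFour_le`).
[cite: Panis2023Triviality, proof of Theorem 5.5 ("Applying the tree diagram bound"), pp. 21–22] -/
theorem sum_box_abs_ursellFour_le (hβ : 0 ≤ β) (hJ : ∀ x y, 0 ≤ J x y)
    (hT : ∀ x y z t : Site d, ENNReal.ofReal |ursellFour J β x y z t| ≤
      2 * ∑' u : Site d, ENNReal.ofReal (pairCorrelation J β x u * pairCorrelation J β y u *
        pairCorrelation J β z u * pairCorrelation J β t u))
    {N : ℕ} {g : Site d → ℝ} (hg0 : ∀ u, 0 ≤ g u) (hgs : Summable g) (hFg : ∀ u, twoPointBoxSum J β N u ^ 4 ≤ g u) :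
    ∑ x ∈ Fintype.piFinset (fun _ : Fin 4 => box d N), |ursellFour J β (x 0) (x 1) (x 2) (x 3)| ≤ 2 * ∑' u, g u := by
  set P : Finset (Fin 4 → Site d) := Fintype.piFinset (fun _ : Fin 4 => box d N) with hP
  set Φ : (Fin 4 → Site d) → Site d → ℝ≥0∞ := fun x u => ∏ i : Fin 4, ENNReal.ofReal (pairCorrelation J β (x i) u) with hΦ
  have step1 : ∑ x ∈ P, ENNReal.ofReal |ursellFour J β (x 0) (x 1) (x 2) (x 3)| ≤ ∑ x ∈ P, 2 * ∑' u : Site d, Φ x u :=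
    Finset.sum_le_sum fun x _ => abs_ursellFour_le_tsum_prod J β hβ hJ hT x
  have step2 : ∑ x ∈ P, 2 * ∑' u : Site d, Φ x u = 2 * ∑' u : Site d, ∑ x ∈ P, Φ x u := by
    rw [← Finset.mul_sum, Summable.tsum_finsetSum fun _ _ => ENNReal.summable]
  have step3 : ∑' u : Site d, ∑ x ∈ P, Φ x u ≤ ∑' u : Site d, ENNReal.ofReal (g u) := by
    refine ENNReal.tsum_le_tsum fun u => ?_
    rw [hΦ, hP, sum_piFinset_prod_pairCorrelation J β hβ hJ N u]
    exact ENNReal.ofReal_le_ofReal (hFg u)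
  have step4 : ∑' u : Site d, ENNReal.ofReal (g u) = ENNReal.ofReal (∑' u, g u) :=
    (ENNReal.ofReal_tsum_of_nonneg hg0 hgs).symm
  have hsum : ENNReal.ofReal (∑ x ∈ P, |ursellFour J β (x 0) (x 1) (x 2) (x 3)|) ≤ ENNReal.ofReal (2 * ∑' u, g u) := by
    rw [ENNReal.ofReal_sum_of_nonneg fun x _ => abs_nonneg _, ENNReal.ofReal_mul (by norm_num : (0:ℝ) ≤ 2),
      ENNReal.ofReal_ofNat, ← step4]
    exact step1.trans (step2.le.trans (by gcongr))
  exact (ENNReal.ofReal_le_ofReal_iff (mul_nonneg (by norm_num) (tsum_nonneg hg0))).1 hsum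

end RowSumsGen

/-! ### Bookkeeping of the powers of `L` and `R` in general dimension (no powers of `β`) -/

section AlgebraGen

/-- `L^d · (L^{2-η})² · (L^d)⁻² = L^{4-2η-d}` for `L > 0`. [folklore] -/
theorem rpow_bookkeeping_near_gen {L : ℝ} (hL : 0 < L) (d : ℕ) (η : ℝ) :
    L ^ d * (L ^ (2 - η)) ^ 2 * ((L ^ d)⁻¹) ^ 2 = L ^ (4 - 2 * η - d) := by
  rw [← Real.rpow_natCast L d, ← Real.rpow_neg hL.le, ← Real.rpow_natCast (L ^ (2 - η)) 2,
    ← Real.rpow_natCast (L ^ (-(d : ℝ))) 2, ← Real.rpow_mul hL.le, ← Real.rpow_mul hL.le,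
    ← Real.rpow_add hL, ← Real.rpow_add hL]
  congr 1
  push_cast
  ring

/-- `L^{4d} · L^{-(d-4+2η)} · (L^d)⁻² · (L^d)⁻² = L^{4-2η-d}` for `L > 0`. [folklore] -/
theorem rpow_bookkeeping_far_gen {L : ℝ} (hL : 0 < L) (d : ℕ) (η : ℝ) :
    L ^ (4 * d) * L ^ (-((d : ℝ) - 4 + 2 * η)) * ((L ^ d)⁻¹) ^ 2 * ((L ^ d)⁻¹) ^ 2 = L ^ (4 - 2 * η - d) := by
  rw [← Real.rpow_natCast L (4 * d), ← Real.rpow_natCast L d, ← Real.rpow_neg hL.le,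
    ← Real.rpow_natCast (L ^ (-(d : ℝ))) 2, ← Real.rpow_mul hL.le,
    ← Real.rpow_add hL, ← Real.rpow_add hL, ← Real.rpow_add hL]
  congr 1
  push_cast
  ring

/-- **The near term** of `S(β,L,f)` in `ℤ^d`:
`2|Λ_{(d+1)RL}| ((1+(3d)^d)((d+2)R)^d χ_L)⁴/Σ_L² ≤ K₁ R^{5d} L^{4-2η-d}` granted `χ_L ≤ C₄L^{2-η}` and
`χ_L ≤ C₂L^{-d}Σ_L`, with `K₁ = 2(3(d+1))^d(1+(3d)^d)⁴(d+2)^{4d}C₄²C₂²`.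
[cite: Panis2023Triviality, proof of Theorem 5.5, bound on (1) (last two displays), p. 22] -/
theorem near_term_le_gen {C₂ C₄ χ V η : ℝ} {R L : ℕ} (hχ0 : 0 ≤ χ) (hV : 1 ≤ V)
    (hR : 1 ≤ R) (hL : 1 ≤ L) (hχ4 : χ ≤ C₄ * (L : ℝ) ^ (2 - η)) (hχV : χ ≤ C₂ * ((L : ℝ) ^ d)⁻¹ * V) :
    2 * (#(box d ((d + 1) * (R * L))) : ℝ) *
        ((1 + ((3 * d) ^ d : ℕ)) * (((d + 2 : ℕ) : ℝ) * R) ^ d * χ) ^ 4 / V ^ 2 ≤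
      (2 * (3 * ((d + 1 : ℕ) : ℝ)) ^ d * (1 + ((3 * d) ^ d : ℕ)) ^ 4 * ((d + 2 : ℕ) : ℝ) ^ (4 * d) * C₄ ^ 2 * C₂ ^ 2) *
        (R : ℝ) ^ (5 * d) * (L : ℝ) ^ (4 - 2 * η - d) := by
  have hR0 : (0 : ℝ) < R := by exact_mod_cast hR
  have hL0 : (0 : ℝ) < L := by exact_mod_cast hL
  have hR1 : (1 : ℝ) ≤ R := by exact_mod_cast hR
  have hL1 : (1 : ℝ) ≤ L := by exact_mod_cast hL
  have hV0 : 0 < V := by linarith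
  have hratio : χ / V ≤ C₂ * ((L : ℝ) ^ d)⁻¹ := by
    rw [div_le_iff₀ hV0]
    exact hχV
  have hratio0 : 0 ≤ χ / V := div_nonneg hχ0 hV0.le
  have hcard : (#(box d ((d + 1) * (R * L))) : ℝ) ≤ (3 * ((d + 1 : ℕ) : ℝ)) ^ d * (R : ℝ) ^ d * (L : ℝ) ^ d := by
    rw [card_box, Nat.cast_pow, ← mul_pow, ← mul_pow]
    apply pow_le_pow_left₀ (Nat.cast_nonneg _)
    push_cast
    have h1 : (1 : ℝ) ≤ (R : ℝ) * L := one_le_mul_of_one_le_of_one_le hR1 hL1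
    have hd0 : (0 : ℝ) ≤ d := Nat.cast_nonneg d
    nlinarith [mul_nonneg hd0 (sub_nonneg.2 h1)]
  have hRpow : (R : ℝ) ^ d * (R : ℝ) ^ (4 * d) = (R : ℝ) ^ (5 * d) := by
    rw [← pow_add]
    congr 1
    ring
  have hRd : (((d + 2 : ℕ) : ℝ) * R) ^ d = ((d + 2 : ℕ) : ℝ) ^ d * (R : ℝ) ^ d := mul_pow _ _ _
  have e1 : 2 * (#(box d ((d + 1) * (R * L))) : ℝ) *
        ((1 + ((3 * d) ^ d : ℕ)) * (((d + 2 : ℕ) : ℝ) * R) ^ d * χ) ^ 4 / V ^ 2 =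
      2 * (#(box d ((d + 1) * (R * L))) : ℝ) *
        ((1 + ((3 * d) ^ d : ℕ)) ^ 4 * (((d + 2 : ℕ) : ℝ) ^ d) ^ 4 * ((R : ℝ) ^ d) ^ 4) * (χ ^ 2 * (χ / V) ^ 2) := by
    rw [hRd]
    field_simp
  rw [e1]
  have hsq1 : χ ^ 2 ≤ (C₄ * (L : ℝ) ^ (2 - η)) ^ 2 := pow_le_pow_left₀ hχ0 hχ4 2
  have hsq2 : (χ / V) ^ 2 ≤ (C₂ * ((L : ℝ) ^ d)⁻¹) ^ 2 := pow_le_pow_left₀ hratio0 hratio 2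
  have hpow4 : (((d + 2 : ℕ) : ℝ) ^ d) ^ 4 = ((d + 2 : ℕ) : ℝ) ^ (4 * d) := by rw [← pow_mul, mul_comm]
  have hpowR : ((R : ℝ) ^ d) ^ 4 = (R : ℝ) ^ (4 * d) := by rw [← pow_mul, mul_comm]
  calc 2 * (#(box d ((d + 1) * (R * L))) : ℝ) *
        ((1 + ((3 * d) ^ d : ℕ)) ^ 4 * (((d + 2 : ℕ) : ℝ) ^ d) ^ 4 * ((R : ℝ) ^ d) ^ 4) * (χ ^ 2 * (χ / V) ^ 2)
      ≤ 2 * ((3 * ((d + 1 : ℕ) : ℝ)) ^ d * (R : ℝ) ^ d * (L : ℝ) ^ d) *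
          ((1 + ((3 * d) ^ d : ℕ)) ^ 4 * (((d + 2 : ℕ) : ℝ) ^ d) ^ 4 * ((R : ℝ) ^ d) ^ 4) *
          ((C₄ * (L : ℝ) ^ (2 - η)) ^ 2 * (C₂ * ((L : ℝ) ^ d)⁻¹) ^ 2) := by gcongr
    _ = (2 * (3 * ((d + 1 : ℕ) : ℝ)) ^ d * (1 + ((3 * d) ^ d : ℕ)) ^ 4 * (((d + 2 : ℕ) : ℝ) ^ d) ^ 4 * C₄ ^ 2 * C₂ ^ 2) *
          ((R : ℝ) ^ d * ((R : ℝ) ^ d) ^ 4) * ((L : ℝ) ^ d * ((L : ℝ) ^ (2 - η)) ^ 2 * (((L : ℝ) ^ d)⁻¹) ^ 2) := by ring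
    _ = (2 * (3 * ((d + 1 : ℕ) : ℝ)) ^ d * (1 + ((3 * d) ^ d : ℕ)) ^ 4 * ((d + 2 : ℕ) : ℝ) ^ (4 * d) * C₄ ^ 2 * C₂ ^ 2) *
          (R : ℝ) ^ (5 * d) * (L : ℝ) ^ (4 - 2 * η - d) := by
        rw [rpow_bookkeeping_near_gen hL0 d η, hpow4, hpowR, hRpow]

/-- **The far term** of `S(β,L,f)` in `ℤ^d`:
`2 B_far · 2d3^{d-1}((d+1)RL)^{d-q}/(q-d) / Σ_L² ≤ K₂ R^{4d} L^{4-2η-d}` with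
`B_far = |Λ_{RL}|⁴(χ_L/L^d)²(C_E2^{d-2+η})²`, `q = 2(d-2+η)`, granted `χ_L ≤ C₂L^{-d}Σ_L`, with
`K₂ = 2·2d3^{d-1}(C_E2^{d-2+η})²3^{4d}C₂²/(d-4+2η)`.
[cite: Panis2023Triviality, proof of Theorem 5.5, bound on (2) (last display), p. 22] -/
theorem far_term_le_gen {C₂ CE χ V η : ℝ} {R L : ℕ} (hχ0 : 0 ≤ χ) (hV : 1 ≤ V)
    (hdη : 4 < (d : ℝ) + 2 * η) (hR : 1 ≤ R) (hL : 1 ≤ L) (hχV : χ ≤ C₂ * ((L : ℝ) ^ d)⁻¹ * V) :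
    2 * ((((2 * (R * L) + 1 : ℕ) : ℝ) ^ d) ^ 4 * (χ / (L : ℝ) ^ d) ^ 2 * (CE * (2 : ℝ) ^ ((d : ℝ) - 2 + η)) ^ 2 *
        (2 * d * (3 : ℝ) ^ (d - 1) * (((d + 1) * (R * L) : ℕ) : ℝ) ^ ((d : ℝ) - 2 * ((d : ℝ) - 2 + η)) /
          (2 * ((d : ℝ) - 2 + η) - d))) / V ^ 2 ≤
      (2 * (2 * d * (3 : ℝ) ^ (d - 1)) / ((d : ℝ) - 4 + 2 * η) * (CE * (2 : ℝ) ^ ((d : ℝ) - 2 + η)) ^ 2 *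
          (3 : ℝ) ^ (4 * d) * C₂ ^ 2) *
        (R : ℝ) ^ (4 * d) * (L : ℝ) ^ (4 - 2 * η - d) := by
  have hR0 : (0 : ℝ) < R := by exact_mod_cast hR
  have hL0 : (0 : ℝ) < L := by exact_mod_cast hL
  have hR1 : (1 : ℝ) ≤ R := by exact_mod_cast hR
  have hV0 : 0 < V := by linarith
  set s : ℝ := (d : ℝ) - 4 + 2 * η with hs
  have hs0 : 0 < s := by rw [hs]; linarith
  have hsne : s ≠ 0 := hs0.ne'
  have hLne : (L : ℝ) ≠ 0 := hL0.ne'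
  have hVne : V ≠ 0 := hV0.ne'
  have hLdne : (L : ℝ) ^ d ≠ 0 := pow_ne_zero _ hLne
  have e_exp1 : (d : ℝ) - 2 * ((d : ℝ) - 2 + η) = -s := by rw [hs]; ring
  have e_exp2 : 2 * ((d : ℝ) - 2 + η) - d = s := by rw [hs]; ring
  rw [e_exp1, e_exp2]
  have hratio : χ / V ≤ C₂ * ((L : ℝ) ^ d)⁻¹ := by
    rw [div_le_iff₀ hV0]
    exact hχV
  have hratio0 : 0 ≤ χ / V := div_nonneg hχ0 hV0.le
  have hsq2 : (χ / V) ^ 2 ≤ (C₂ * ((L : ℝ) ^ d)⁻¹) ^ 2 := pow_le_pow_left₀ hratio0 hratio 2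
  -- volume factor
  have hvol : (((2 * (R * L) + 1 : ℕ) : ℝ) ^ d) ^ 4 ≤ (3 : ℝ) ^ (4 * d) * (R : ℝ) ^ (4 * d) * (L : ℝ) ^ (4 * d) := by
    rw [← pow_mul, mul_comm d 4, ← mul_pow, ← mul_pow]
    apply pow_le_pow_left₀ (Nat.cast_nonneg _)
    push_cast
    have hL1 : (1 : ℝ) ≤ L := by exact_mod_cast hL
    have h1 : (1 : ℝ) ≤ (R : ℝ) * L := one_le_mul_of_one_le_of_one_le hR1 hL1
    linarith
  -- tail factor `((d+1)RL)^{-s} ≤ L^{-s}`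
  have hM : (((d + 1) * (R * L) : ℕ) : ℝ) ^ (-s) ≤ (L : ℝ) ^ (-s) := by
    have hsplit : (((d + 1) * (R * L) : ℕ) : ℝ) = (((d + 1) * R : ℕ) : ℝ) * L := by push_cast; ring
    rw [hsplit, Real.mul_rpow (Nat.cast_nonneg _) hL0.le]
    have h1 : (1 : ℝ) ≤ (((d + 1) * R : ℕ) : ℝ) := by exact_mod_cast (show 1 ≤ (d + 1) * R by nlinarith)
    have h2 : (((d + 1) * R : ℕ) : ℝ) ^ (-s) ≤ 1 := Real.rpow_le_one_of_one_le_of_nonpos h1 (by linarith)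
    have h3 : 0 ≤ (L : ℝ) ^ (-s) := Real.rpow_nonneg hL0.le _
    calc (((d + 1) * R : ℕ) : ℝ) ^ (-s) * (L : ℝ) ^ (-s) ≤ 1 * (L : ℝ) ^ (-s) := mul_le_mul_of_nonneg_right h2 h3
      _ = (L : ℝ) ^ (-s) := one_mul _
  have hM0 : 0 ≤ (((d + 1) * (R * L) : ℕ) : ℝ) ^ (-s) := Real.rpow_nonneg (Nat.cast_nonneg _) _
  set K : ℝ := (CE * (2 : ℝ) ^ ((d : ℝ) - 2 + η)) ^ 2 with hK
  set Kd : ℝ := 2 * d * (3 : ℝ) ^ (d - 1) with hKd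
  have e1 : 2 * ((((2 * (R * L) + 1 : ℕ) : ℝ) ^ d) ^ 4 * (χ / (L : ℝ) ^ d) ^ 2 * K *
        (Kd * (((d + 1) * (R * L) : ℕ) : ℝ) ^ (-s) / s)) / V ^ 2 =
      (2 * Kd / s * K) * ((((2 * (R * L) + 1 : ℕ) : ℝ) ^ d) ^ 4 *
        ((((d + 1) * (R * L) : ℕ) : ℝ) ^ (-s) * ((((L : ℝ) ^ d)⁻¹) ^ 2 * (χ / V) ^ 2))) := by
    field_simp
  rw [e1]
  calc (2 * Kd / s * K) * ((((2 * (R * L) + 1 : ℕ) : ℝ) ^ d) ^ 4 *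
        ((((d + 1) * (R * L) : ℕ) : ℝ) ^ (-s) * ((((L : ℝ) ^ d)⁻¹) ^ 2 * (χ / V) ^ 2)))
      ≤ (2 * Kd / s * K) * (((3 : ℝ) ^ (4 * d) * (R : ℝ) ^ (4 * d) * (L : ℝ) ^ (4 * d)) *
        ((L : ℝ) ^ (-s) * ((((L : ℝ) ^ d)⁻¹) ^ 2 * (C₂ * ((L : ℝ) ^ d)⁻¹) ^ 2))) := by gcongr
    _ = (2 * Kd / s * K * (3 : ℝ) ^ (4 * d) * C₂ ^ 2) * (R : ℝ) ^ (4 * d) *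
        ((L : ℝ) ^ (4 * d) * (L : ℝ) ^ (-s) * (((L : ℝ) ^ d)⁻¹) ^ 2 * (((L : ℝ) ^ d)⁻¹) ^ 2) := by ring
    _ = (2 * Kd / s * K * (3 : ℝ) ^ (4 * d) * C₂ ^ 2) * (R : ℝ) ^ (4 * d) * (L : ℝ) ^ (4 - 2 * η - d) := by
        rw [hs, rpow_bookkeeping_far_gen hL0 d η]
    _ = _ := by rw [hK, hKd, hs]

end AlgebraGen

/-! ### `S(β,L,f)` in `ℤ^d`, every `d ≥ 1`, from MMS2 and the infrared bound -/

section MainGen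

variable (J : Site d → Site d → ℝ) (β : ℝ)

/-- **`χ_L ≤ C₄ L^{2-η}` from the infrared bound** in `ℤ^d`
(`C₄ = 1 + 2d3^{d-1}C_E(1 + 1/(2-η))`): the term `x = 0` plus `C_E ∑_{x∈Λ_L∖0} |x|_∞^{-(d-2+η)}` (the
`d = 3` copy is `boxSusceptibility_le_of_irb`).
[cite: Panis2023Triviality, proof of Theorem 5.5, bound on (1) ("χ_L(β) ≤ C_4 L^{2-η}"), p. 22] -/
theorem boxSusceptibility_le_of_irb_gen (hd : 1 ≤ d) (hβ : 0 ≤ β) (hJ : ∀ x y, 0 ≤ J x y) {η : ℝ} (hη2 : η < 2)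
    {CE : ℝ} (hCE : 0 ≤ CE) (hE : ∀ x : Site d, x ≠ 0 → pairCorrelation J β 0 x ≤ CE / ‖x‖ ^ ((d : ℝ) - 2 + η))
    {L : ℕ} (hL : 1 ≤ L) :
    boxSusceptibility J β L ≤ (1 + 2 * d * (3 : ℝ) ^ (d - 1) * CE * (1 + 1 / (2 - η))) * (L : ℝ) ^ (2 - η) := by
  have hL0 : (0 : ℝ) < L := by exact_mod_cast hL
  have hLp : 1 ≤ (L : ℝ) ^ (2 - η) := Real.one_le_rpow (by exact_mod_cast hL) (by linarith)
  have hsplit : boxSusceptibility J β L =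
      ∑ x ∈ box d L \ box d 0, pairCorrelation J β 0 x + ∑ x ∈ box d 0, pairCorrelation J β 0 x := by
    rw [boxSusceptibility, Finset.sum_sdiff (box_mono d (Nat.zero_le L))]
  have hzero : ∑ x ∈ box d 0, pairCorrelation J β 0 x ≤ 1 := by
    calc ∑ x ∈ box d 0, pairCorrelation J β 0 x ≤ ∑ _x ∈ box d 0, (1 : ℝ) :=
          Finset.sum_le_sum fun x _ => (le_abs_self _).trans (abs_pairCorrelation_le_one J β hβ hJ 0 x)
      _ = 1 := by rw [Finset.sum_const, card_box, nsmul_eq_mul, mul_one]; norm_num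
  have hterm : ∀ x ∈ box d L \ box d 0,
      pairCorrelation J β 0 x ≤ CE * ((Site.supNorm x : ℝ)) ^ (-((d : ℝ) - 2 + η)) := by
    intro x hx
    rw [Finset.mem_sdiff, mem_box_iff_supNorm_le, mem_box_iff_supNorm_le] at hx
    have hpos : 0 < Site.supNorm x := by omega
    have hx0 : x ≠ 0 := fun h => by rw [h, Site.supNorm_eq_zero_iff.2 rfl] at hpos; exact lt_irrefl 0 hpos
    have hn0 : (0 : ℝ) < Site.supNorm x := by exact_mod_cast hpos
    have h := hE x hx0
    rw [Site.norm_eq_supNorm] at h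
    rwa [Real.rpow_neg hn0.le, ← div_eq_mul_inv]
  set Kd : ℝ := 2 * d * (3 : ℝ) ^ (d - 1) with hKd
  have hKd0 : 0 ≤ Kd := by rw [hKd]; positivity
  calc boxSusceptibility J β L
      = ∑ x ∈ box d L \ box d 0, pairCorrelation J β 0 x + ∑ x ∈ box d 0, pairCorrelation J β 0 x := hsplit
    _ ≤ ∑ x ∈ box d L \ box d 0, CE * ((Site.supNorm x : ℝ)) ^ (-((d : ℝ) - 2 + η)) + 1 := by
        linarith [Finset.sum_le_sum hterm, hzero]
    _ = CE * ∑ x ∈ box d L \ box d 0, ((Site.supNorm x : ℝ)) ^ (-((d : ℝ) - 2 + η)) + 1 := by rw [Finset.mul_sum]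
    _ ≤ CE * (Kd * (1 + 1 / (2 - η)) * (L : ℝ) ^ (2 - η)) + 1 := by
        have h := sum_box_rpow_neg_supNorm_le hd hη2 hL
        rw [← hKd] at h
        linarith [mul_le_mul_of_nonneg_left h hCE]
    _ ≤ CE * (Kd * (1 + 1 / (2 - η)) * (L : ℝ) ^ (2 - η)) + (L : ℝ) ^ (2 - η) := by linarith
    _ = (1 + Kd * CE * (1 + 1 / (2 - η))) * (L : ℝ) ^ (2 - η) := by ring
    _ = (1 + 2 * d * (3 : ℝ) ^ (d - 1) * CE * (1 + 1 / (2 - η))) * (L : ℝ) ^ (2 - η) := by rw [hKd]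

/-- **Panis's bound on `S(β,L,f)` in `ℤ^d`, every `d ≥ 1`, from MMS2 and the infrared bound** (page 22
of the source with the Messager–Miracle-Solé comparison in place of Theorem 3.18, formalised for a
general translation-invariant `J ≥ 0` and a set `B` of admissible `β ≥ 0` on which the two-point inputs
hold uniformly): the tree diagram bound (in `ℝ≥0∞`), MMS2 `⟨σ₀σ_y⟩ ≤ ⟨σ₀σ_x⟩` for `d|x| ≤ |y|`, the
infrared bound `⟨σ₀σ_x⟩ ≤ C_E|x|^{-(d-2+η)}` with `0 ≤ d-2+η`, `η < 2`, `d + 2η > 4`, and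
`χ_L ≤ C₂L^{-d}Σ_L` give a constant `K` with `S(β,L,R) ≤ K R^{5d} / L^{d+2η-4}` for all `β ∈ B`,
`L, R ≥ 1` (near region `Λ_{(d+1)RL}`: `F(u) ≤ (1+(3d)^d)((d+2)R)^dχ_L`; far region: two factors
`χ_L/L^d`, two factors `C_E2^{d-2+η}|u|^{-(d-2+η)}`, tail `∑_{|u|>(d+1)RL}|u|^{-(2d-4+2η)} ≲ (RL)^{-(d-4+2η)}`;
then `χ_L/Σ_L ≤ C₂L^{-d}` twice and `χ_L ≤ C₄L^{2-η}`).
[cite: Panis2023Triviality, proof of Theorem 5.5, bounds on (1) and (2), p. 22, with Corollary 3.3 (MMS2)] -/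
theorem ursellFourBoxSum_le_of_mms_irb (hd : 1 ≤ d) (hJ : ∀ x y, 0 ≤ J x y)
    (hJt : ∀ a x y, J (x + a) (y + a) = J x y) (B : Set ℝ) (hB0 : ∀ β ∈ B, 0 ≤ β)
    (hT : ∀ β ∈ B, ∀ x y z t : Site d, ENNReal.ofReal |ursellFour J β x y z t| ≤
      2 * ∑' u : Site d, ENNReal.ofReal (pairCorrelation J β x u * pairCorrelation J β y u *
        pairCorrelation J β z u * pairCorrelation J β t u))
    (hmms : ∀ β ∈ B, ∀ x y : Site d, (d : ℝ) * ‖x‖ ≤ ‖y‖ → pairCorrelation J β 0 y ≤ pairCorrelation J β 0 x)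
    {η : ℝ} (hp0 : 0 ≤ (d : ℝ) - 2 + η) (hη2 : η < 2) (hdη : 4 < (d : ℝ) + 2 * η)
    {CE : ℝ} (hCE : 0 ≤ CE)
    (hE : ∀ β ∈ B, ∀ x : Site d, x ≠ 0 → pairCorrelation J β 0 x ≤ CE / ‖x‖ ^ ((d : ℝ) - 2 + η))
    {C₂ : ℝ} (hX : ∀ β ∈ B, ∀ L : ℕ, 1 ≤ L →
      boxSusceptibility J β L ≤ C₂ * ((L : ℝ) ^ d)⁻¹ * blockVariance J β L) :
    ∃ K : ℝ, 0 < K ∧ ∀ β ∈ B, ∀ L R : ℕ, 1 ≤ L → 1 ≤ R →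
      ursellFourBoxSum J β L R ≤ K * (R : ℝ) ^ (5 * d) / (L : ℝ) ^ ((d : ℝ) + 2 * η - 4) := by
  have h2η : 0 < 2 - η := by linarith
  have hs0 : 0 < (d : ℝ) - 4 + 2 * η := by linarith
  set C₄ : ℝ := 1 + 2 * d * (3 : ℝ) ^ (d - 1) * CE * (1 + 1 / (2 - η)) with hC₄
  set K₁ : ℝ := 2 * (3 * ((d + 1 : ℕ) : ℝ)) ^ d * (1 + ((3 * d) ^ d : ℕ)) ^ 4 * ((d + 2 : ℕ) : ℝ) ^ (4 * d) *
      C₄ ^ 2 * C₂ ^ 2 with hK₁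
  set K₂ : ℝ := 2 * (2 * d * (3 : ℝ) ^ (d - 1)) / ((d : ℝ) - 4 + 2 * η) * (CE * (2 : ℝ) ^ ((d : ℝ) - 2 + η)) ^ 2 *
      (3 : ℝ) ^ (4 * d) * C₂ ^ 2 with hK₂
  have hK₁0 : 0 ≤ K₁ := by positivity
  have hK₂0 : 0 ≤ K₂ := by positivity
  refine ⟨K₁ + K₂ + 1, by positivity, ?_⟩
  intro β hβB L R hL hR
  have hβ : 0 ≤ β := hB0 β hβB
  have hL0 : (0 : ℝ) < L := by exact_mod_cast hL
  have hR0 : (0 : ℝ) < R := by exact_mod_cast hR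
  have hR1 : (1 : ℝ) ≤ R := by exact_mod_cast hR
  -- the inputs at this `β`
  have hTβ := hT β hβB
  have hmmsβ := hmms β hβB
  have hEβ := hE β hβB
  have hXβ : boxSusceptibility J β L ≤ C₂ * ((L : ℝ) ^ d)⁻¹ * blockVariance J β L := hX β hβB L hL
  -- the quantities of p. 22
  set χ : ℝ := boxSusceptibility J β L with hχ
  set V : ℝ := blockVariance J β L with hV
  have hχ0 : 0 ≤ χ := boxSusceptibility_nonneg J β hβ hJ L
  have hV1 : 1 ≤ V := one_le_blockVariance J β hβ hJ L
  have hχ4 : χ ≤ C₄ * (L : ℝ) ^ (2 - η) := boxSusceptibility_le_of_irb_gen J β hd hβ hJ hη2 hCE hEβ hL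
  set A : ℝ := ((1 + ((3 * d) ^ d : ℕ)) * (((d + 2 : ℕ) : ℝ) * R) ^ d * χ) ^ 4 with hA
  set Bf : ℝ := (((2 * (R * L) + 1 : ℕ) : ℝ) ^ d) ^ 4 * (χ / (L : ℝ) ^ d) ^ 2 *
      (CE * (2 : ℝ) ^ ((d : ℝ) - 2 + η)) ^ 2 with hBf
  set q : ℝ := 2 * ((d : ℝ) - 2 + η) with hq
  have hA0 : 0 ≤ A := by positivity
  have hB0' : 0 ≤ Bf := by positivity
  have hqd : (d : ℝ) < q := by rw [hq]; linarith
  have hLN : L ≤ R * L := Nat.le_mul_of_pos_left L (by omega)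
  have hM1 : 1 ≤ (d + 1) * (R * L) := Nat.one_le_iff_ne_zero.2 (Nat.mul_ne_zero (by omega) (by
    exact Nat.mul_ne_zero (by omega) (by omega)))
  -- the majorant of `F⁴`
  have hFg : ∀ u : Site d, twoPointBoxSum J β (R * L) u ^ 4 ≤ fourthPowerMajorant A Bf q ((d + 1) * (R * L)) u := by
    intro u
    by_cases hu : u ∈ box d ((d + 1) * (R * L))
    · rw [fourthPowerMajorant, if_pos hu, hA]
      have hnear := twoPointBoxSum_le_near J β hβ hJ hJt hmmsβ (N := R * L) (M := (d + 1) * (R * L)) hL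
        (hLN.trans (Nat.le_add_right _ _)) hu
      have e : (((R * L + (d + 1) * (R * L) : ℕ) : ℝ)) / L = ((d + 2 : ℕ) : ℝ) * R := by
        push_cast
        field_simp
        ring
      rw [e] at hnear
      exact pow_le_pow_left₀ (twoPointBoxSum_nonneg J β hβ hJ _ u) hnear 4
    · rw [fourthPowerMajorant, if_neg hu, hBf, hq]
      have hu' : (d + 1) * (R * L) + 1 ≤ Site.supNorm u := by
        rw [mem_box_iff_supNorm_le] at hu
        omega
      exact twoPointBoxSum_pow_four_le_far J β hd hβ hJ hJt hmmsβ hp0 hCE hEβ hL hLN hu'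
  obtain ⟨hsum, htsum⟩ := summable_fourthPowerMajorant hd hA0 hB0' hqd hM1
  have hU := sum_box_abs_ursellFour_le J β hβ hJ hTβ (fourthPowerMajorant_nonneg hA0 hB0' q _) hsum hFg
  -- the two terms
  have hnear : 2 * (#(box d ((d + 1) * (R * L))) : ℝ) *
        ((1 + ((3 * d) ^ d : ℕ)) * (((d + 2 : ℕ) : ℝ) * R) ^ d * χ) ^ 4 / V ^ 2 ≤
      K₁ * (R : ℝ) ^ (5 * d) * (L : ℝ) ^ (4 - 2 * η - d) :=
    near_term_le_gen hχ0 hV1 hR hL hχ4 hXβ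
  have hfar : 2 * ((((2 * (R * L) + 1 : ℕ) : ℝ) ^ d) ^ 4 * (χ / (L : ℝ) ^ d) ^ 2 * (CE * (2 : ℝ) ^ ((d : ℝ) - 2 + η)) ^ 2 *
        (2 * d * (3 : ℝ) ^ (d - 1) * (((d + 1) * (R * L) : ℕ) : ℝ) ^ ((d : ℝ) - 2 * ((d : ℝ) - 2 + η)) /
          (2 * ((d : ℝ) - 2 + η) - d))) / V ^ 2 ≤
      K₂ * (R : ℝ) ^ (4 * d) * (L : ℝ) ^ (4 - 2 * η - d) :=
    far_term_le_gen hχ0 hV1 hdη hR hL hXβ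
  -- assemble
  have hS : ursellFourBoxSum J β L R ≤
      K₁ * (R : ℝ) ^ (5 * d) * (L : ℝ) ^ (4 - 2 * η - d) + K₂ * (R : ℝ) ^ (4 * d) * (L : ℝ) ^ (4 - 2 * η - d) := by
    have h1 : ursellFourBoxSum J β L R ≤
        2 * ((#(box d ((d + 1) * (R * L))) : ℝ) * A +
          Bf * (2 * d * (3 : ℝ) ^ (d - 1) * (((d + 1) * (R * L) : ℕ) : ℝ) ^ ((d : ℝ) - q) / (q - d))) / V ^ 2 := by
      rw [ursellFourBoxSum]
      exact div_le_div_of_nonneg_right (hU.trans (by linarith only [htsum])) (sq_nonneg _)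
    have h2 : 2 * ((#(box d ((d + 1) * (R * L))) : ℝ) * A +
          Bf * (2 * d * (3 : ℝ) ^ (d - 1) * (((d + 1) * (R * L) : ℕ) : ℝ) ^ ((d : ℝ) - q) / (q - d))) / V ^ 2 =
        2 * (#(box d ((d + 1) * (R * L))) : ℝ) *
            ((1 + ((3 * d) ^ d : ℕ)) * (((d + 2 : ℕ) : ℝ) * R) ^ d * χ) ^ 4 / V ^ 2 +
        2 * ((((2 * (R * L) + 1 : ℕ) : ℝ) ^ d) ^ 4 * (χ / (L : ℝ) ^ d) ^ 2 * (CE * (2 : ℝ) ^ ((d : ℝ) - 2 + η)) ^ 2 *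
          (2 * d * (3 : ℝ) ^ (d - 1) * (((d + 1) * (R * L) : ℕ) : ℝ) ^ ((d : ℝ) - 2 * ((d : ℝ) - 2 + η)) /
            (2 * ((d : ℝ) - 2 + η) - d))) / V ^ 2 := by
      rw [hA, hBf, hq]
      ring
    rw [h2] at h1
    linarith only [h1, hnear, hfar]
  -- `R^{4d} ≤ R^{5d}`, `L^{4-2η-d} = 1/L^{d+2η-4}`
  set X : ℝ := (R : ℝ) ^ (5 * d) * (L : ℝ) ^ (4 - 2 * η - d) with hXdef
  have hLt0 : 0 ≤ (L : ℝ) ^ (4 - 2 * η - d) := Real.rpow_nonneg hL0.le _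
  have hX0 : 0 ≤ X := mul_nonneg (pow_nonneg hR0.le _) hLt0
  have hRb : (R : ℝ) ^ (4 * d) ≤ (R : ℝ) ^ (5 * d) := pow_le_pow_right₀ hR1 (by omega)
  have hterm2 : K₂ * (R : ℝ) ^ (4 * d) * (L : ℝ) ^ (4 - 2 * η - d) ≤ K₂ * X := by
    rw [hXdef, ← mul_assoc]
    exact mul_le_mul_of_nonneg_right (mul_le_mul_of_nonneg_left hRb hK₂0) hLt0
  have hpow : X = (R : ℝ) ^ (5 * d) / (L : ℝ) ^ ((d : ℝ) + 2 * η - 4) := by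
    rw [hXdef, show (4 : ℝ) - 2 * η - d = -((d : ℝ) + 2 * η - 4) by ring, Real.rpow_neg hL0.le, div_eq_mul_inv]
  calc ursellFourBoxSum J β L R
      ≤ K₁ * (R : ℝ) ^ (5 * d) * (L : ℝ) ^ (4 - 2 * η - d) + K₂ * (R : ℝ) ^ (4 * d) * (L : ℝ) ^ (4 - 2 * η - d) := hS
    _ ≤ K₁ * X + K₂ * X := by
        rw [hXdef, ← mul_assoc]
        exact add_le_add le_rfl hterm2
    _ ≤ (K₁ + K₂ + 1) * X := by
        have p3 : (K₁ + K₂ + 1) * X = K₁ * X + K₂ * X + X := by ring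
        rw [p3]
        linarith only [hX0]
    _ = (K₁ + K₂ + 1) * (R : ℝ) ^ (5 * d) / (L : ℝ) ^ ((d : ℝ) + 2 * η - 4) := by
        rw [hpow, mul_div_assoc]

end MainGen

end LongRangeIsing

open LongRangeIsing

/-! ### Two further printed infrared inputs (named facts): Proposition 3.8 (IRB) for every `α`, and
the infrared bound in `d ≤ 2` (Remark 3.9) -/

/-- NAMED FACT — **the infrared bound (IRB) of Proposition 3.8 (Panis 2023), for the algebraically
decaying couplings and every `α > 0`.** "Proposition 3.8 (Infrared bound). Let `d ≥ 3`. There exists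
`C = C(d) > 0` such that for every `β ≤ β_c(ρ)`, and every `x ∈ ℤ^d ∖ {0}`, … In particular, for all
`x ∈ ℤ^d ∖ {0}`, (IRB) `S_{ρ,β}(x) ≤ S_{ρ,β_c(ρ)}(x) ≤ C/(β_c(ρ)|J||x|^{d-2})`", for reflection-positive
models with `J` satisfying (A1)–(A5) (§3.1, example (iii): `J_{x,y} = C|x-y|₁^{-d-α}`, `α, C > 0`).
Vendored for `J_{x,y} = C₀|x-y|₁^{-d-α}`, `C₀, α > 0` (any `α`, in particular `α = 2` and `α > 2`, where
`d - α∧2 = d - 2`), `d ≥ 3`, `0 < β ≤ β_c`, the constant absorbing `1/(β_c|J|)` (it may depend on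
`d, C₀, α`); `|x|` is the supremum norm. Users take `(h : panis_infraredBound_rp)`.
[cite: Panis2023Triviality, Proposition 3.8, display (IRB)] -/
def panis_infraredBound_rp : Prop :=
  ∀ (d : ℕ), 3 ≤ d → ∀ (C₀ α : ℝ), 0 < C₀ → 0 < α →
    ∃ C : ℝ, 0 < C ∧ ∀ (β : ℝ), 0 < β → β ≤ LongRangeIsing.criticalBeta (algebraicCoupling d C₀ α) →
      ∀ (x : Site d), x ≠ 0 →
        pairCorrelation (algebraicCoupling d C₀ α) β 0 x ≤ C / ‖x‖ ^ ((d : ℝ) - 2)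

/-- NAMED FACT — **the infrared bound for algebraically decaying reflection-positive couplings in
`d ≤ 2` (Panis 2023, §3.3, first display of p. 16 with Remark 3.9).** "Together with [Proposition 3.8],
we get that for algebraic decay interactions, `⟨τ₀τ_x⟩_{ρ,β} ≤ (C/(β|J|)) · |x|^{-(d-α)}` [case
`α ∈ (0,2)`]" (for every `β ≤ β_c(ρ)`, `x ≠ 0`, as in Proposition 3.8), and "Remark 3.9. The above bound
is also valid for `d = 2` in the case `α ∈ (0,2)` and for `d = 1` with `α ∈ (0,1)`, since in both cases
`|p|^{-α}` is locally integrable." Vendored for `J_{x,y} = C₀|x-y|₁^{-d-α}`, `C₀ > 0`, in exactly these two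
cases, for `0 < β ≤ β_c`, with the printed `1/β` kept and `1/|J|` absorbed into the constant (which may
depend on `d, C₀, α`); `|x|` is the supremum norm. (The `β`-uniform form `C/β_c(ρ)` of the last display of
p. 16 follows at `β ≤ β_c` from this one at `β_c` and Griffiths' monotonicity in `β`,
`pairCorrelation_mono_beta`.) Users take `(h : panis_infraredBound_algebraic_lowDim)`.
[cite: Panis2023Triviality, §3.3, first display of p. 16 (case α ∈ (0,2)) and Remark 3.9] -/
def panis_infraredBound_algebraic_lowDim : Prop :=
  ∀ (d : ℕ) (α : ℝ), (d = 2 ∧ α < 2) ∨ (d = 1 ∧ α < 1) → ∀ (C₀ : ℝ), 0 < C₀ → 0 < α →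
    ∃ C : ℝ, 0 < C ∧ ∀ (β : ℝ), 0 < β → β ≤ LongRangeIsing.criticalBeta (algebraicCoupling d C₀ α) →
      ∀ (x : Site d), x ≠ 0 →
        pairCorrelation (algebraicCoupling d C₀ α) β 0 x ≤ C / (β * ‖x‖ ^ ((d : ℝ) - α))

/-! ### `panis_ursellFourBoxSum_le` (all `d ≥ 1`) from the tree diagram bound and the infrared bounds -/

/-- **The infrared input in `η`-form.** For `J_{x,y} = C₀|x-y|₁^{-d-α}`, `d ≥ 1`, `d - 2(α∧2) > 0`, the
three printed infrared bounds give one constant `C_E ≥ 0` with `⟨σ₀σ_x⟩_β ≤ C_E/|x|^{d-2+η}`,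
`η = 2 - α∧2`, for all `0 < β ≤ β_c`, `x ≠ 0`: for `α ≥ 2` (then `d ≥ 5`, `η = 0`) Proposition 3.8
(IRB); for `α < 2`, `d ≥ 3` the last display of p. 16; for `d = 2` (then `α < 1`) and `d = 1` (then
`α < 1/2`) Remark 3.9 at `β_c` and Griffiths' monotonicity in `β`. [cite: Panis2023Triviality, Proposition 3.8 (IRB), §3.3 p. 16 with Remark 3.9, §3.6 last display of p. 16, Remarks 5.3–5.4] -/
theorem exists_irb_eta_form (hI : panis_infraredBound_algebraic) (hIrp : panis_infraredBound_rp)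
    (hI2 : panis_infraredBound_algebraic_lowDim) {d : ℕ} (hd : 1 ≤ d) {C₀ α : ℝ} (hC₀ : 0 < C₀) (hα : 0 < α)
    (hexp : 0 < (d : ℝ) - 2 * min α 2) :
    ∃ CE : ℝ, 0 ≤ CE ∧ ∀ (β : ℝ), 0 < β → β ≤ LongRangeIsing.criticalBeta (algebraicCoupling d C₀ α) →
      ∀ (x : Site d), x ≠ 0 →
        pairCorrelation (algebraicCoupling d C₀ α) β 0 x ≤ CE / ‖x‖ ^ ((d : ℝ) - 2 + (2 - min α 2)) := by
  rcases le_or_gt 2 α with hα2 | hα2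
  · -- `α ≥ 2`: Proposition 3.8 (IRB), exponent `d - 2`
    have hmin : min α 2 = 2 := min_eq_right hα2
    have hd3 : 3 ≤ d := by
      rw [hmin] at hexp
      have : (4 : ℝ) < d := by linarith
      exact_mod_cast (show (3 : ℝ) ≤ d by linarith)
    obtain ⟨C, hC, h⟩ := hIrp d hd3 C₀ α hC₀ hα
    refine ⟨C, hC.le, fun β hβ hβc x hx => ?_⟩
    rw [hmin, show (d : ℝ) - 2 + (2 - 2) = (d : ℝ) - 2 by ring]
    exact h β hβ hβc x hx
  · have hmin : min α 2 = α := min_eq_left hα2.le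
    rw [hmin]
    -- the low-dimensional route: the printed `1/β` bound at `β_c`, then monotonicity in `β`
    have lowDim : ∀ (hcase : (d = 2 ∧ α < 2) ∨ (d = 1 ∧ α < 1)),
        ∃ CE : ℝ, 0 ≤ CE ∧ ∀ (β : ℝ), 0 < β → β ≤ LongRangeIsing.criticalBeta (algebraicCoupling d C₀ α) →
          ∀ (x : Site d), x ≠ 0 →
            pairCorrelation (algebraicCoupling d C₀ α) β 0 x ≤ CE / ‖x‖ ^ ((d : ℝ) - 2 + (2 - α)) := by
      intro hcase
      obtain ⟨C, hC, h⟩ := hI2 d α hcase C₀ hC₀ hα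
      refine ⟨C / LongRangeIsing.criticalBeta (algebraicCoupling d C₀ α),
        div_nonneg hC.le (criticalBeta_nonneg _), fun β hβ hβc x hx => ?_⟩
      have hβc0 : 0 < LongRangeIsing.criticalBeta (algebraicCoupling d C₀ α) := lt_of_lt_of_le hβ hβc
      have hmono := pairCorrelation_mono_beta (algebraicCoupling d C₀ α) hβ.le hβc
        (algebraicCoupling_nonneg hC₀.le α) 0 x
      have hat := h _ hβc0 le_rfl x hx
      rw [show (d : ℝ) - 2 + (2 - α) = (d : ℝ) - α by ring, div_div]
      exact hmono.trans hat
    rcases (show d = 1 ∨ d = 2 ∨ 3 ≤ d by omega) with rfl | rfl | hd3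
    · -- `d = 1`, `α < 1/2`
      have hα1 : α < 1 := by rw [hmin] at hexp; push_cast at hexp; linarith
      exact lowDim (Or.inr ⟨rfl, hα1⟩)
    · -- `d = 2`, `α < 1`
      exact lowDim (Or.inl ⟨rfl, hα2⟩)
    · -- `d ≥ 3`, `α < 2`: the last display of p. 16
      obtain ⟨C, hC, h⟩ := hI d hd3 C₀ α hC₀ hα hα2.ne
      refine ⟨C, hC.le, fun β hβ hβc x hx => ?_⟩
      rw [show (d : ℝ) - 2 + (2 - α) = (d : ℝ) - α by ring]
      have h' := h β hβ hβc x hx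
      rwa [hmin] at h'

/-- `1 ≤ (β_c² + 1)(β⁻⁴ ∨ β⁻²)` for `0 < β ≤ β_c` (the powers of `β` of the vendored shape are recovered
from a `β`-free bound). [folklore] -/
theorem one_le_criticalFactor_mul_max {β βc : ℝ} (hβ : 0 < β) (hββc : β ≤ βc) :
    1 ≤ (βc ^ 2 + 1) * max (β ^ (-(4 : ℝ))) (β ^ (-(2 : ℝ))) := by
  have hβ2 : β ^ (-(2 : ℝ)) = (β ^ 2)⁻¹ := by
    rw [Real.rpow_neg hβ.le]
    have h := Real.rpow_natCast β 2
    push_cast at h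
    rw [h]
  have hle : (β ^ 2)⁻¹ ≤ max (β ^ (-(4 : ℝ))) (β ^ (-(2 : ℝ))) := hβ2 ▸ le_max_right _ _
  have hβsq : 0 < β ^ 2 := by positivity
  have hkey : 1 ≤ (βc ^ 2 + 1) * (β ^ 2)⁻¹ := by
    rw [← div_eq_mul_inv, le_div_iff₀ hβsq, one_mul]
    nlinarith [mul_self_nonneg (βc - β), hβ.le]
  exact hkey.trans (mul_le_mul_of_nonneg_left hle (by positivity))

/-- **The named fact `panis_ursellFourBoxSum_le` in every dimension `d ≥ 1`, from the tree diagram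
bound and the printed infrared bounds** (last display of p. 16; Proposition 3.8 (IRB); Remark 3.9),
the Messager–Miracle-Solé monotonicity (`panis_mms_two_point_monotone_holds`) and `χ_L ≤ C₂L^{-d}Σ_L`
(`panis_boxSusceptibility_le_blockVariance_of_mms`) being theorems: for `J_{x,y} = C₀|x-y|₁^{-d-α}`
with `d - 2(α∧2) > 0` there are `C, γ > 0` (`γ = 5d`) with `S(β,L,R) ≤ C(β⁻⁴ ∨ β⁻²)R^γ/L^{d-2(α∧2)}`
for all `0 < β ≤ β_c`, `L, R ≥ 1` (through `ursellFourBoxSum_le_of_mms_irb` with `η = 2 - α∧2`,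
`d + 2η - 4 = d - 2(α∧2)`, and `1 ≤ (β_c²+1)(β⁻⁴∨β⁻²)`). This covers the printed case `d = 1` of Theorem
1.2, which the printed proof of Theorem 5.5 (Theorem 3.18, `d ≥ 2`) does not.
[cite: Panis2023Triviality, proof of Theorem 5.5, bounds on (1) and (2) (p. 22), Remark 5.4, Theorem 1.2] -/
theorem panis_ursellFourBoxSum_le_of_facts (hT : panis_treeDiagramBound) (hI : panis_infraredBound_algebraic)
    (hIrp : panis_infraredBound_rp) (hI2 : panis_infraredBound_algebraic_lowDim) : panis_ursellFourBoxSum_le := by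
  intro d hd C₀ α hC₀ hα hexp
  set J := algebraicCoupling d C₀ α with hJdef
  have hJ0 : ∀ x y, 0 ≤ J x y := algebraicCoupling_nonneg hC₀.le α
  have hJt : ∀ a x y, J (x + a) (y + a) = J x y := algebraicCoupling_add C₀ α
  set η : ℝ := 2 - min α 2 with hη
  have hη2 : η < 2 := by rw [hη]; linarith [lt_min hα two_pos]
  have hdη : 4 < (d : ℝ) + 2 * η := by rw [hη]; linarith
  have hp0 : 0 ≤ (d : ℝ) - 2 + η := by
    rw [hη]
    have : (1 : ℝ) ≤ d := by exact_mod_cast hd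
    linarith [min_le_right α 2]
  set B : Set ℝ := Set.Ioc 0 (LongRangeIsing.criticalBeta J) with hB
  have hB0 : ∀ β ∈ B, 0 ≤ β := fun β hβ => hβ.1.le
  obtain ⟨C₂, -, hX'⟩ := panis_boxSusceptibility_le_blockVariance_of_mms panis_mms_two_point_monotone_holds
    d hd C₀ α hC₀ hα
  obtain ⟨CE, hCE, hE⟩ := exists_irb_eta_form hI hIrp hI2 hd hC₀ hα hexp
  obtain ⟨K, hK, hbound⟩ := ursellFourBoxSum_le_of_mms_irb J hd hJ0 hJt B hB0
    (fun β hβ => hT d hd C₀ α hC₀ hα β hβ.1 hβ.2)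
    (fun β hβ x y hxy => panis_mms_two_point_monotone_holds d hd C₀ α hC₀ hα β hβ.1 x y hxy)
    hp0 hη2 hdη hCE (fun β hβ x hx => hE β hβ.1 hβ.2 x hx) (fun β hβ L hL => hX' β hβ.1 hβ.2 L hL)
  set βc : ℝ := LongRangeIsing.criticalBeta J with hβcdef
  refine ⟨K * (βc ^ 2 + 1), ((5 * d : ℕ) : ℝ), by positivity, by positivity, fun β hβ hβc L R hL hR => ?_⟩
  have h := hbound β ⟨hβ, hβc⟩ L R hL hR
  rw [show (d : ℝ) + 2 * η - 4 = (d : ℝ) - 2 * min α 2 by rw [hη]; ring] at h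
  have hL0 : (0 : ℝ) < L := by exact_mod_cast hL
  have hR0 : (0 : ℝ) < R := by exact_mod_cast hR
  have hden : 0 < (L : ℝ) ^ ((d : ℝ) - 2 * min α 2) := Real.rpow_pos_of_pos hL0 _
  have hRγ : (R : ℝ) ^ (5 * d) = (R : ℝ) ^ (((5 * d : ℕ)) : ℝ) := (Real.rpow_natCast (R : ℝ) (5 * d)).symm
  have hfac := one_le_criticalFactor_mul_max hβ hβc
  have hKR : 0 ≤ K * (R : ℝ) ^ (5 * d) / (L : ℝ) ^ ((d : ℝ) - 2 * min α 2) := by positivity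
  calc ursellFourBoxSum J β L R ≤ K * (R : ℝ) ^ (5 * d) / (L : ℝ) ^ ((d : ℝ) - 2 * min α 2) := h
    _ ≤ K * (R : ℝ) ^ (5 * d) / (L : ℝ) ^ ((d : ℝ) - 2 * min α 2) *
          ((βc ^ 2 + 1) * max (β ^ (-(4 : ℝ))) (β ^ (-(2 : ℝ)))) := le_mul_of_one_le_right hKR hfac
    _ = K * (βc ^ 2 + 1) * max (β ^ (-(4 : ℝ))) (β ^ (-(2 : ℝ))) * (R : ℝ) ^ (((5 * d : ℕ)) : ℝ) /
          (L : ℝ) ^ ((d : ℝ) - 2 * min α 2) := by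
        rw [← hRγ]
        ring

/-- **Theorem 1.2 (all `d ≥ 1`) from printed inputs**: the moment-generating-function display
(`panis_mgfDeviation_le_ursellFourBoxSum`), the tree diagram bound and the three printed infrared
bounds, through `panis_thm12_of_inputs`. [cite: Panis2023Triviality, Theorem 1.2 and proof of Theorem 5.5 (pp. 21–22)] -/
theorem panis_thm12_of_facts (hMgf : panis_mgfDeviation_le_ursellFourBoxSum) (hT : panis_treeDiagramBound)
    (hI : panis_infraredBound_algebraic) (hIrp : panis_infraredBound_rp)
    (hI2 : panis_infraredBound_algebraic_lowDim) : panis_thm12 :=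
  panis_thm12_of_inputs hMgf (panis_ursellFourBoxSum_le_of_facts hT hI hIrp hI2)

end Literature.Barriers.CriticalPhenomena

end
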